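import Literature.NumberTheory.Automorphic.ArchRankOneLimitFormulaGroup   -- ★ p840661 (R1G) B-p17 (g24): §1 `tendsto_deriv_two_sin_smul_integral_conj_of_chart_identity` with the EXPLICIT constant `(−2π·C₁)`
import HarnessLib

/-!
# (R1G) SIGNED: Harish-Chandra's limit formula on `U(e₀,e₁)` (`e₀e₁ < 0`) with a NEGATIVE constant — `∂_ψ[2 sin ψ · ∫_{G₂} f(h·diag(z e^{iψ}, z e^{−iψ})·h⁻¹) dμ₂] → C·f(z·1)`, `C < 0`
# (Rogawski 1990 §8.2 p. 119∕p. 123 «the constant in the limit formula for `H′` differs by a SIGN from that for `H`»; Varadarajan 1989 §6.4 Thm 22 `(1∕i)F′(1) = −π f(1)`)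

Topic `NumberTheory/Automorphic`; ns `Literature.NumberTheory.Automorphic.UnitaryGroup`; THEOREMS ONLY (no `def`, no instance, no notation, no axiom, no `sorry`).  Cell `pub/hodgecm-mathlib`,
ENGINE T1 (crux H413 = `stmt-HodgeConjecture-24833`); floor-1½ brick **(J-sgn) SIGN HALF** under rows #88 (ST-∞) ∕ #111 (S-d) (F0P3a-p02 (g10) LEDGER v2 R1 sub-item (A4) «the constant identity»;
LEAD F0P3a-plan (g9) T8-52∕T8-57; B-p17 (g24) «=» + recipe 04:29:24Z; author F0P3a-p05 (g11)).  BY IMPORT over ★ (R1G) `ArchRankOneLimitFormulaGroup` (B-p17, p840661): its §1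
`tendsto_deriv_two_sin_smul_integral_conj_of_chart_identity` already carries the EXPLICIT constant `(−(2π)·C₁) • f(z•1)` with `0 < C₁` (F0P3a-p07's HAT-BOX ★ p840627
`exists_integral_comp_conj_diag_eq_smul_integral_chart`), so `C = −2πC₁ < 0` on the standard group; §2∕§3 there carry `C` UNCHANGED through the torus-fixing conjugation — only the quantifier
text says `C ≠ 0`.  This file re-runs §2–§4 of ★ (R1G) token-for-token with `C ≠ 0 ↦ C < 0` (proofs identical; `mul_ne_zero … ↦ mul_neg_of_neg_of_pos …`), in a separate module so that
★ (R1G) and its consumer ★ p840819 `archLimitFormulaNoncompactWall_holds` are untouched.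

WHY THE SIGN MATTERS (the (ST-∞)∕(L-use) assembly, LEDGER v2 §3 (A4)).  At a split-singular `γ₀` the jump formula (★ J1∕(δ)∕(γ) p840417∕p840879∕p840906) produces, per relabelling, either the
compact-wall term `+2·∫_{G_w} Θ(g t g⁻¹) dν` (★ (J-cw), POSITIVE coefficient on the class `⟦γ₀′⟧` with `e(γ₀′) = −1`) or `c·`(singular orbital integral at `⟦γ₀⟧`, `e(γ₀) = +1`) with `c = c₀·C`,
`c₀ > 0` (★ (d3a) averaging constant); with `C < 0` the two coefficients have OPPOSITE signs — exactly what lets the right-hand side be a POSITIVE multiple of the Kottwitz-SIGNED sum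
`Φ(γ₀, ·) − Φ(γ₀′, ·)` (★ FILE B `stableOrbitalIntegralRel_kottwitzSign_mul_circleDiagonal_eq_sub`) for singular members that are honest (positive) measures.  The MAGNITUDE identity between
`|c|` and the compact-wall mass under compatible `(ν_H, ν_{H′})` is the separate (V6) item.

* §1 `tendsto_deriv_orbitalIntegral_transport_neg` (★ §2 with `C < 0`), §2 `tendsto_deriv_orbitalIntegral_of_formCongr_neg`, `exists_tendsto_deriv_two_sin_smul_orbitalIntegral_of_chart_identity_neg`
  (★ §3 with `C < 0`), §3 **`exists_tendsto_deriv_two_sin_smul_orbitalIntegral_neg : ∃ C : ℝ, C < 0 ∧ …`** (★ §4's statement VERBATIM with `C ≠ 0 ↦ C < 0`).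
HONEST LABEL: HC_CM is proved only modulo the printed citations until rung 0 closes; this file is the sign bookkeeping of an in-house theorem and pays nothing by itself.
Refs: [Varadarajan1989] §6.4 Thm 22, Lemma 21; [Rogawski1990] §8.2 Prop. 8.2.1 p. 119, p. 123; [PlatonovRapinchuk1994] §2.3.
-/

set_option autoImplicit false

namespace Literature.NumberTheory.Automorphic.UnitaryGroup

open _root_.MeasureTheory Set Filter _root_.Topology _root_.Complex
open scoped Real Matrix.Norms.Operator MatrixGroups

variable {E : Type*} [NormedAddCommGroup E] [NormedSpace ℝ E] [CompleteSpace E]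

/-! ## §1 Transport of the limit formula (signed) along a torus-fixing conjugation `S′ ≃ₜ* S`, `h′ ↦ T h′ T⁻¹` -/

omit [CompleteSpace E] in
/-- The test function transported by `Ad(T⁻¹)`, `X ↦ f(T⁻¹ X T)`, is again `C¹` with compact support, and agrees with `f` at the central
points `z • 1`. [folklore] -/
private theorem contDiff_hasCompactSupport_comp_conj' (T : GL (Fin 2) ℂ) {f : Matrix (Fin 2) (Fin 2) ℂ → E}
    (hf : ContDiff ℝ 1 f) (hfc : HasCompactSupport f) :
    ContDiff ℝ 1 (fun X : Matrix (Fin 2) (Fin 2) ℂ =>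
        f (((T⁻¹ : GL (Fin 2) ℂ) : Matrix (Fin 2) (Fin 2) ℂ) * X * (T : Matrix (Fin 2) (Fin 2) ℂ))) ∧
      HasCompactSupport (fun X : Matrix (Fin 2) (Fin 2) ℂ =>
        f (((T⁻¹ : GL (Fin 2) ℂ) : Matrix (Fin 2) (Fin 2) ℂ) * X * (T : Matrix (Fin 2) (Fin 2) ℂ))) := by
  refine ⟨hf.comp ((contDiff_const.mul contDiff_id).mul contDiff_const), ?_⟩
  -- `X ↦ T⁻¹ X T` is a homeomorphism of `M₂(ℂ)` (inverse `X ↦ T X T⁻¹`)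
  let φ : Matrix (Fin 2) (Fin 2) ℂ ≃ₜ Matrix (Fin 2) (Fin 2) ℂ :=
    { toFun := fun X => ((T⁻¹ : GL (Fin 2) ℂ) : Matrix (Fin 2) (Fin 2) ℂ) * X * (T : Matrix (Fin 2) (Fin 2) ℂ)
      invFun := fun X => (T : Matrix (Fin 2) (Fin 2) ℂ) * X * ((T⁻¹ : GL (Fin 2) ℂ) : Matrix (Fin 2) (Fin 2) ℂ)
      left_inv := fun X => by
        simp only [← Matrix.mul_assoc, Units.mul_inv, Matrix.one_mul]
        rw [Matrix.mul_assoc, Units.mul_inv, Matrix.mul_one]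
      right_inv := fun X => by
        simp only [← Matrix.mul_assoc, Units.inv_mul, Matrix.one_mul]
        rw [Matrix.mul_assoc, Units.inv_mul, Matrix.mul_one]
      continuous_toFun := (continuous_const.mul continuous_id).mul continuous_const
      continuous_invFun := (continuous_const.mul continuous_id).mul continuous_const }
  exact hfc.comp_homeomorph φ

omit [CompleteSpace E] in
/-- **Transport step.**  Let `S, S′ ≤ GL₂(ℂ)` both contain the circle torus and let `e : S′ ≃ₜ* S`, `h′ ↦ T h′ T⁻¹` be conjugation by a `T` commuting
with the torus (e.g. the tree's `unitaryGroupOfFormCongrOfEq` along a diagonal `T`, or the identity map between two spellings of the same subgroup).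
If the limit formula with differentiability holds on `S` for every Haar measure (constant `C < 0` depending on the measure), it holds on `S′`:
the Haar measure is pushed forward along `e`, the test function is replaced by `X ↦ f(T⁻¹ X T)` (same value at `z • 1`), and
`h′·γ·h′⁻¹ ↦ T⁻¹ (h·γ·h⁻¹) T` because `T γ = γ T`. [cite: Varadarajan1989, §6.4 Thm 22; Rogawski1990, §8.2 p. 119] -/
theorem tendsto_deriv_orbitalIntegral_transport_neg (S S' : Subgroup (GL (Fin 2) ℂ)) [MeasurableSpace S] [BorelSpace S]
    [MeasurableSpace S'] [BorelSpace S'] (hS : ∀ w : Fin 2 → Circle, circleDiagonal 2 w ∈ S)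
    (hS' : ∀ w : Fin 2 → Circle, circleDiagonal 2 w ∈ S') (e : S' ≃ₜ* S) (T : GL (Fin 2) ℂ)
    (he : ∀ h' : S', ((e h' : S) : GL (Fin 2) ℂ) = T * (h' : GL (Fin 2) ℂ) * T⁻¹)
    (hT : ∀ w : Fin 2 → Circle, T * circleDiagonal 2 w = circleDiagonal 2 w * T)
    (hL : ∀ (μ : Measure S) [μ.IsHaarMeasure], ∃ C : ℝ, C < 0 ∧
      ∀ (f : Matrix (Fin 2) (Fin 2) ℂ → E), ContDiff ℝ 1 f → HasCompactSupport f → ∀ z : Circle,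
        Tendsto (fun ψ : ℝ => deriv (fun ψ : ℝ => (2 * Real.sin ψ) •
            ∫ h : S, f (((h * ⟨circleDiagonal 2 ![z * Circle.exp ψ, z * Circle.exp (-ψ)], hS _⟩ * h⁻¹ : S) :
              GL (Fin 2) ℂ) : Matrix (Fin 2) (Fin 2) ℂ) ∂μ) ψ)
          (𝓝[≠] 0) (𝓝 (C • f ((z : ℂ) • (1 : Matrix (Fin 2) (Fin 2) ℂ)))) ∧
        ∀ ψ ∈ Ioo (-1 : ℝ) 1, ψ ≠ 0 → DifferentiableAt ℝ (fun ψ : ℝ => (2 * Real.sin ψ) •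
            ∫ h : S, f (((h * ⟨circleDiagonal 2 ![z * Circle.exp ψ, z * Circle.exp (-ψ)], hS _⟩ * h⁻¹ : S) :
              GL (Fin 2) ℂ) : Matrix (Fin 2) (Fin 2) ℂ) ∂μ) ψ)
    (μ' : Measure S') [μ'.IsHaarMeasure] :
    ∃ C : ℝ, C < 0 ∧
      ∀ (f : Matrix (Fin 2) (Fin 2) ℂ → E), ContDiff ℝ 1 f → HasCompactSupport f → ∀ z : Circle,
        Tendsto (fun ψ : ℝ => deriv (fun ψ : ℝ => (2 * Real.sin ψ) •
            ∫ h : S', f (((h * ⟨circleDiagonal 2 ![z * Circle.exp ψ, z * Circle.exp (-ψ)], hS' _⟩ * h⁻¹ : S') :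
              GL (Fin 2) ℂ) : Matrix (Fin 2) (Fin 2) ℂ) ∂μ') ψ)
          (𝓝[≠] 0) (𝓝 (C • f ((z : ℂ) • (1 : Matrix (Fin 2) (Fin 2) ℂ)))) ∧
        ∀ ψ ∈ Ioo (-1 : ℝ) 1, ψ ≠ 0 → DifferentiableAt ℝ (fun ψ : ℝ => (2 * Real.sin ψ) •
            ∫ h : S', f (((h * ⟨circleDiagonal 2 ![z * Circle.exp ψ, z * Circle.exp (-ψ)], hS' _⟩ * h⁻¹ : S') :
              GL (Fin 2) ℂ) : Matrix (Fin 2) (Fin 2) ℂ) ∂μ') ψ := by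
  -- push the Haar measure forward along `e`
  obtain ⟨C, hC, hLC⟩ := hL (μ'.map e)
  refine ⟨C, hC, fun f hf hfc z => ?_⟩
  obtain ⟨hfT, hfTc⟩ := contDiff_hasCompactSupport_comp_conj' (E := E) T hf hfc
  obtain ⟨hlim, hdiff⟩ := hLC _ hfT hfTc z
  -- `e.symm` on underlying elements
  have hesymm : ∀ h : S, (((e.symm h : S') : GL (Fin 2) ℂ)) = T⁻¹ * (h : GL (Fin 2) ℂ) * T := fun h => by
    have h1 := he (e.symm h)
    rw [e.apply_symm_apply] at h1
    rw [h1]; group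
  -- the integrals agree for every `ψ`
  have key : (fun ψ : ℝ => (2 * Real.sin ψ) •
      ∫ h : S', f (((h * ⟨circleDiagonal 2 ![z * Circle.exp ψ, z * Circle.exp (-ψ)], hS' _⟩ * h⁻¹ : S') :
        GL (Fin 2) ℂ) : Matrix (Fin 2) (Fin 2) ℂ) ∂μ') =
      fun ψ : ℝ => (2 * Real.sin ψ) •
        ∫ h : S, (fun X : Matrix (Fin 2) (Fin 2) ℂ =>
            f (((T⁻¹ : GL (Fin 2) ℂ) : Matrix (Fin 2) (Fin 2) ℂ) * X * (T : Matrix (Fin 2) (Fin 2) ℂ)))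
          (((h * ⟨circleDiagonal 2 ![z * Circle.exp ψ, z * Circle.exp (-ψ)], hS _⟩ * h⁻¹ : S) :
            GL (Fin 2) ℂ) : Matrix (Fin 2) (Fin 2) ℂ) ∂(μ'.map e) := by
    funext ψ
    congr 1
    rw [show (Measure.map (⇑e) μ' : Measure S) = Measure.map (⇑e.toHomeomorph.toMeasurableEquiv) μ' from rfl,
      integral_map_equiv]
    refine integral_congr_ae (Eventually.of_forall fun h' => ?_)
    -- the measurable equivalence IS `e` (definitionally); restate the goal through `e h'`
    change f _ = f (((T⁻¹ : GL (Fin 2) ℂ) : Matrix (Fin 2) (Fin 2) ℂ) *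
      (((e h' * ⟨circleDiagonal 2 ![z * Circle.exp ψ, z * Circle.exp (-ψ)], hS _⟩ * (e h')⁻¹ : S) :
        GL (Fin 2) ℂ) : Matrix (Fin 2) (Fin 2) ℂ) * (T : Matrix (Fin 2) (Fin 2) ℂ))
    -- conjugation bookkeeping in `GL₂(ℂ)`: `T γ = γ T`
    have hc : T⁻¹ * circleDiagonal 2 ![z * Circle.exp ψ, z * Circle.exp (-ψ)] * T =
        circleDiagonal 2 ![z * Circle.exp ψ, z * Circle.exp (-ψ)] := by
      rw [mul_assoc, ← hT, ← mul_assoc, inv_mul_cancel, one_mul]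
    have hGL : T⁻¹ * (((e h' * ⟨circleDiagonal 2 ![z * Circle.exp ψ, z * Circle.exp (-ψ)], hS _⟩ * (e h')⁻¹ : S) :
        GL (Fin 2) ℂ)) * T =
        ((h' * ⟨circleDiagonal 2 ![z * Circle.exp ψ, z * Circle.exp (-ψ)], hS' _⟩ * h'⁻¹ : S') : GL (Fin 2) ℂ) := by
      simp only [Subgroup.coe_mul, Subgroup.coe_inv, he]
      calc T⁻¹ * (T * (h' : GL (Fin 2) ℂ) * T⁻¹ * circleDiagonal 2 ![z * Circle.exp ψ, z * Circle.exp (-ψ)] *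
            (T * (h' : GL (Fin 2) ℂ) * T⁻¹)⁻¹) * T
          = (h' : GL (Fin 2) ℂ) * (T⁻¹ * circleDiagonal 2 ![z * Circle.exp ψ, z * Circle.exp (-ψ)] * T) *
              (h' : GL (Fin 2) ℂ)⁻¹ := by group
        _ = (h' : GL (Fin 2) ℂ) * circleDiagonal 2 ![z * Circle.exp ψ, z * Circle.exp (-ψ)] *
              (h' : GL (Fin 2) ℂ)⁻¹ := by rw [hc]
    rw [← hGL, Units.val_mul, Units.val_mul]
  rw [key]
  exact ⟨by simpa using hlim, hdiff⟩

/-! ## §2 The unitary groups `U(diag(e₀, e₁))`, `e₀e₁ < 0`: congruence to the standard form and the final statement -/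

/-- The circle torus lies in every diagonal unitary group `U(σ, (diag a).map σ)`. [folklore] -/
private theorem circleDiagonal_mem_unitaryGroupOfForm_diagonal_map' {L : Type*} [CommRing L] (σ : L →+* ℂ)
    (a : Fin 2 → L) (w : Fin 2 → Circle) :
    circleDiagonal 2 w ∈ unitaryGroupOfForm (starRingEnd ℂ) ((Matrix.diagonal a).map σ) := by
  rw [Matrix.diagonal_map (map_zero σ)]
  exact circleDiagonal_mem_unitaryGroupOfForm_diagonal 2 w _

/-- `U(σ, −H) = U(σ, H)`. [folklore] -/
private theorem unitaryGroupOfForm_neg_eq' (H : Matrix (Fin 2) (Fin 2) ℂ) :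
    unitaryGroupOfForm (starRingEnd ℂ) (-H) = unitaryGroupOfForm (starRingEnd ℂ) H := by
  ext g; rw [mem_unitaryGroupOfForm_iff, mem_unitaryGroupOfForm_iff, Matrix.mul_neg, Matrix.neg_mul, neg_inj]

/-- A diagonal `T ∈ GL₂(ℂ)` commutes with the circle torus. [folklore] -/
private theorem diagonal_mul_circleDiagonal_comm' (T : GL (Fin 2) ℂ) (d : Fin 2 → ℂ)
    (hTd : (T : Matrix (Fin 2) (Fin 2) ℂ) = Matrix.diagonal d) (w : Fin 2 → Circle) :
    T * circleDiagonal 2 w = circleDiagonal 2 w * T := by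
  apply Units.ext; simp only [Units.val_mul, coe_circleDiagonal, hTd, Matrix.diagonal_mul_diagonal]; congr 1; funext i; ring

omit [CompleteSpace E] in
/-- **Congruence step.**  If `σ(T)ᵀ J T = H` for a DIAGONAL `T ∈ GL₂(ℂ)` and the limit formula (with differentiability) holds on `U(J)`
for every Borel structure and every Haar measure, then it holds on `U(H)` with the same kind of constant (★ `unitaryGroupOfFormCongrOfEq`,
`h′ ↦ T h′ T⁻¹`, + `tendsto_deriv_orbitalIntegral_transport_neg`). [cite: Varadarajan1989, §6.4 Thm 22; Rogawski1990, §8.2 p. 119] -/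
theorem tendsto_deriv_orbitalIntegral_of_formCongr_neg (J H : Matrix (Fin 2) (Fin 2) ℂ) (T : GL (Fin 2) ℂ) (d : Fin 2 → ℂ)
    (hTd : (T : Matrix (Fin 2) (Fin 2) ℂ) = Matrix.diagonal d) (hTJ : formCongr (starRingEnd ℂ) T J = H)
    (hSJ : ∀ w : Fin 2 → Circle, circleDiagonal 2 w ∈ unitaryGroupOfForm (starRingEnd ℂ) J)
    (hSH : ∀ w : Fin 2 → Circle, circleDiagonal 2 w ∈ unitaryGroupOfForm (starRingEnd ℂ) H)
    (hL : ∀ [MeasurableSpace ↥(unitaryGroupOfForm (starRingEnd ℂ) J)] [BorelSpace ↥(unitaryGroupOfForm (starRingEnd ℂ) J)] (μ : Measure ↥(unitaryGroupOfForm (starRingEnd ℂ) J)) [μ.IsHaarMeasure], ∃ C : ℝ, C < 0 ∧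
      ∀ (f : Matrix (Fin 2) (Fin 2) ℂ → E), ContDiff ℝ 1 f → HasCompactSupport f → ∀ z : Circle,
        Tendsto (fun ψ : ℝ => deriv (fun ψ : ℝ => (2 * Real.sin ψ) •
            ∫ h : ↥(unitaryGroupOfForm (starRingEnd ℂ) J), f (((h * ⟨circleDiagonal 2 ![z * Circle.exp ψ, z * Circle.exp (-ψ)], hSJ _⟩ * h⁻¹ : ↥(unitaryGroupOfForm (starRingEnd ℂ) J)) :
              GL (Fin 2) ℂ) : Matrix (Fin 2) (Fin 2) ℂ) ∂μ) ψ)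
          (𝓝[≠] 0) (𝓝 (C • f ((z : ℂ) • (1 : Matrix (Fin 2) (Fin 2) ℂ)))) ∧
        ∀ ψ ∈ Ioo (-1 : ℝ) 1, ψ ≠ 0 → DifferentiableAt ℝ (fun ψ : ℝ => (2 * Real.sin ψ) •
            ∫ h : ↥(unitaryGroupOfForm (starRingEnd ℂ) J), f (((h * ⟨circleDiagonal 2 ![z * Circle.exp ψ, z * Circle.exp (-ψ)], hSJ _⟩ * h⁻¹ : ↥(unitaryGroupOfForm (starRingEnd ℂ) J)) :
              GL (Fin 2) ℂ) : Matrix (Fin 2) (Fin 2) ℂ) ∂μ) ψ)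
    [MeasurableSpace ↥(unitaryGroupOfForm (starRingEnd ℂ) H)] [BorelSpace ↥(unitaryGroupOfForm (starRingEnd ℂ) H)] (μ' : Measure ↥(unitaryGroupOfForm (starRingEnd ℂ) H)) [μ'.IsHaarMeasure] :
    ∃ C : ℝ, C < 0 ∧
      ∀ (f : Matrix (Fin 2) (Fin 2) ℂ → E), ContDiff ℝ 1 f → HasCompactSupport f → ∀ z : Circle,
        Tendsto (fun ψ : ℝ => deriv (fun ψ : ℝ => (2 * Real.sin ψ) •
            ∫ h : ↥(unitaryGroupOfForm (starRingEnd ℂ) H), f (((h * ⟨circleDiagonal 2 ![z * Circle.exp ψ, z * Circle.exp (-ψ)], hSH _⟩ * h⁻¹ : ↥(unitaryGroupOfForm (starRingEnd ℂ) H)) :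
              GL (Fin 2) ℂ) : Matrix (Fin 2) (Fin 2) ℂ) ∂μ') ψ)
          (𝓝[≠] 0) (𝓝 (C • f ((z : ℂ) • (1 : Matrix (Fin 2) (Fin 2) ℂ)))) ∧
        ∀ ψ ∈ Ioo (-1 : ℝ) 1, ψ ≠ 0 → DifferentiableAt ℝ (fun ψ : ℝ => (2 * Real.sin ψ) •
            ∫ h : ↥(unitaryGroupOfForm (starRingEnd ℂ) H), f (((h * ⟨circleDiagonal 2 ![z * Circle.exp ψ, z * Circle.exp (-ψ)], hSH _⟩ * h⁻¹ : ↥(unitaryGroupOfForm (starRingEnd ℂ) H)) :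
              GL (Fin 2) ℂ) : Matrix (Fin 2) (Fin 2) ℂ) ∂μ') ψ := by
  letI : MeasurableSpace ↥(unitaryGroupOfForm (starRingEnd ℂ) J) := borel _
  haveI : BorelSpace ↥(unitaryGroupOfForm (starRingEnd ℂ) J) := ⟨rfl⟩
  exact tendsto_deriv_orbitalIntegral_transport_neg (E := E) (unitaryGroupOfForm (starRingEnd ℂ) J) (unitaryGroupOfForm (starRingEnd ℂ) H) hSJ hSH
    (unitaryGroupOfFormCongrOfEq (starRingEnd ℂ) T J H hTJ) T (fun _ => rfl) (diagonal_mul_circleDiagonal_comm' T d hTd)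
    (fun μ _ => hL μ) μ'

/-- **(R1G) HARISH-CHANDRA'S LIMIT FORMULA ON THE GROUP `U(e₀, e₁)`, `e₀e₁ < 0` (general weights).**  Let `σ : L → ℂ`, `a : Fin 2 → L` with
`σ(a₀), σ(a₁)` real of opposite signs, `G₂ = U(σ, diag(σ a)) ≅ U(1,1)`, `μ₂` ANY Haar measure on `G₂`.  ASSUME the orbit-chart identity (HB) on
the standard group `U(diag(1,−1))` (F0P3a-p07's `ArchRankOneOrbitChart`, taken here as the hypothesis `hHB`).  THEN there is ONE constant `C < 0`
(depending on `μ₂` only) such that for every `f ∈ C¹_c(M₂(ℂ), E)` and every `z ∈ S¹`: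
`lim_{ψ → 0, ψ ≠ 0} ∂_ψ [2 sin ψ · ∫_{G₂} f(h · diag(z e^{iψ}, z e^{−iψ}) · h⁻¹) dμ₂(h)] = C • f(z·1)`, and the normalised orbital integral is
differentiable for `0 < |ψ| < 1`.  Road: (HB) + ★ (M4) `tendsto_deriv_two_sin_smul_integral_chart` on `U(diag(1,−1))` (`C = −2π·C₁`), then the
diagonal congruence `T = diag(√|e₀|, √|e₁|)` (`σ(T)ᵀ (±diag(1,−1)) T = diag(e₀,e₁)`, `U(−J) = U(J)`) transports Haar measure, test function and
torus point.  Consumed by F0P3a-p06's (γ) Bruhat-cutoff descent `archLimitFormulaNoncompactWall_holds`.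
[cite: Varadarajan1989, §6.4 Thm 22; Rogawski1990, §8.2 p. 119] -/
theorem exists_tendsto_deriv_two_sin_smul_orbitalIntegral_of_chart_identity_neg {L : Type*} [CommRing L] (σ : L →+* ℂ)
    (a : Fin 2 → L) (hreal : ∀ i, (σ (a i)).im = 0) (hsgn : (σ (a 0)).re * (σ (a 1)).re < 0)
    (hHB : ∀ [MeasurableSpace ↥(unitaryGroupOfForm (starRingEnd ℂ) (Matrix.diagonal ![(1 : ℂ), -1]))] [BorelSpace ↥(unitaryGroupOfForm (starRingEnd ℂ) (Matrix.diagonal ![(1 : ℂ), -1]))] (μ : Measure ↥(unitaryGroupOfForm (starRingEnd ℂ) (Matrix.diagonal ![(1 : ℂ), -1]))) [μ.IsHaarMeasure],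
      ∃ C₁ : ℝ, 0 < C₁ ∧
        ∀ (f : Matrix (Fin 2) (Fin 2) ℂ → E), Continuous f → HasCompactSupport f → ∀ a b : Circle, a ≠ b →
          ∫ h : ↥(unitaryGroupOfForm (starRingEnd ℂ) (Matrix.diagonal ![(1 : ℂ), -1])), f (((h : GL (Fin 2) ℂ) : Matrix (Fin 2) (Fin 2) ℂ) *
              Matrix.diagonal ![(a : ℂ), (b : ℂ)] * (((h⁻¹ : ↥(unitaryGroupOfForm (starRingEnd ℂ) (Matrix.diagonal ![(1 : ℂ), -1]))) : GL (Fin 2) ℂ) : Matrix (Fin 2) (Fin 2) ℂ)) ∂μ =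
            C₁ • ∫ p in Ioi (1 : ℝ) ×ˢ Ioc (0 : ℝ) (2 * π), f (((b : ℂ)) • (1 : Matrix (Fin 2) (Fin 2) ℂ) +
              (((a : ℂ)) - (b : ℂ)) • !![(p.1 : ℂ), -(Real.sqrt (p.1 * (p.1 - 1)) : ℂ) * cexp (-(p.2 * I));
                (Real.sqrt (p.1 * (p.1 - 1)) : ℂ) * cexp (p.2 * I), 1 - p.1]))
    [MeasurableSpace ↥(unitaryGroupOfForm (starRingEnd ℂ) ((Matrix.diagonal a).map σ))] [BorelSpace ↥(unitaryGroupOfForm (starRingEnd ℂ) ((Matrix.diagonal a).map σ))] (μ₂ : Measure ↥(unitaryGroupOfForm (starRingEnd ℂ) ((Matrix.diagonal a).map σ))) [μ₂.IsHaarMeasure] :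
    ∃ C : ℝ, C < 0 ∧
      ∀ (f : Matrix (Fin 2) (Fin 2) ℂ → E), ContDiff ℝ 1 f → HasCompactSupport f → ∀ z : Circle,
        Tendsto (fun ψ : ℝ => deriv (fun ψ : ℝ => (2 * Real.sin ψ) •
            ∫ h : ↥(unitaryGroupOfForm (starRingEnd ℂ) ((Matrix.diagonal a).map σ)), f (((h * ⟨circleDiagonal 2 ![z * Circle.exp ψ, z * Circle.exp (-ψ)], circleDiagonal_mem_unitaryGroupOfForm_diagonal_map' σ a _⟩ * h⁻¹ : ↥(unitaryGroupOfForm (starRingEnd ℂ) ((Matrix.diagonal a).map σ))) :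
              GL (Fin 2) ℂ) : Matrix (Fin 2) (Fin 2) ℂ) ∂μ₂) ψ)
          (𝓝[≠] 0) (𝓝 (C • f ((z : ℂ) • (1 : Matrix (Fin 2) (Fin 2) ℂ)))) ∧
        ∀ ψ ∈ Ioo (-1 : ℝ) 1, ψ ≠ 0 → DifferentiableAt ℝ (fun ψ : ℝ => (2 * Real.sin ψ) •
            ∫ h : ↥(unitaryGroupOfForm (starRingEnd ℂ) ((Matrix.diagonal a).map σ)), f (((h * ⟨circleDiagonal 2 ![z * Circle.exp ψ, z * Circle.exp (-ψ)], circleDiagonal_mem_unitaryGroupOfForm_diagonal_map' σ a _⟩ * h⁻¹ : ↥(unitaryGroupOfForm (starRingEnd ℂ) ((Matrix.diagonal a).map σ))) :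
              GL (Fin 2) ℂ) : Matrix (Fin 2) (Fin 2) ℂ) ∂μ₂) ψ := by
  -- the target form `H = diag(e₀, e₁)` with real entries
  set e₀ : ℝ := (σ (a 0)).re with he₀
  set e₁ : ℝ := (σ (a 1)).re with he₁
  have hH : (Matrix.diagonal a).map σ = Matrix.diagonal ![(e₀ : ℂ), (e₁ : ℂ)] := by
    rw [Matrix.diagonal_map (map_zero σ)]
    congr 1; funext i
    fin_cases i
    · exact Complex.ext (by simp [he₀]) (by simp [hreal 0])
    · exact Complex.ext (by simp [he₁]) (by simp [hreal 1])
  -- Step 1: the limit formula on a standard group `U(J)` from (HB), for `J = ±diag(1,−1)`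
  have hstd : ∀ (J : Matrix (Fin 2) (Fin 2) ℂ), unitaryGroupOfForm (starRingEnd ℂ) J =
      unitaryGroupOfForm (starRingEnd ℂ) (Matrix.diagonal ![(1 : ℂ), -1]) →
      ∀ (hSJ : ∀ w : Fin 2 → Circle, circleDiagonal 2 w ∈ unitaryGroupOfForm (starRingEnd ℂ) J),
      ∀ [MeasurableSpace ↥(unitaryGroupOfForm (starRingEnd ℂ) J)] [BorelSpace ↥(unitaryGroupOfForm (starRingEnd ℂ) J)] (μ : Measure ↥(unitaryGroupOfForm (starRingEnd ℂ) J)) [μ.IsHaarMeasure], ∃ C : ℝ, C < 0 ∧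
      ∀ (f : Matrix (Fin 2) (Fin 2) ℂ → E), ContDiff ℝ 1 f → HasCompactSupport f → ∀ z : Circle,
        Tendsto (fun ψ : ℝ => deriv (fun ψ : ℝ => (2 * Real.sin ψ) •
            ∫ h : ↥(unitaryGroupOfForm (starRingEnd ℂ) J), f (((h * ⟨circleDiagonal 2 ![z * Circle.exp ψ, z * Circle.exp (-ψ)], hSJ _⟩ * h⁻¹ : ↥(unitaryGroupOfForm (starRingEnd ℂ) J)) :
              GL (Fin 2) ℂ) : Matrix (Fin 2) (Fin 2) ℂ) ∂μ) ψ)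
          (𝓝[≠] 0) (𝓝 (C • f ((z : ℂ) • (1 : Matrix (Fin 2) (Fin 2) ℂ)))) ∧
        ∀ ψ ∈ Ioo (-1 : ℝ) 1, ψ ≠ 0 → DifferentiableAt ℝ (fun ψ : ℝ => (2 * Real.sin ψ) •
            ∫ h : ↥(unitaryGroupOfForm (starRingEnd ℂ) J), f (((h * ⟨circleDiagonal 2 ![z * Circle.exp ψ, z * Circle.exp (-ψ)], hSJ _⟩ * h⁻¹ : ↥(unitaryGroupOfForm (starRingEnd ℂ) J)) :
              GL (Fin 2) ℂ) : Matrix (Fin 2) (Fin 2) ℂ) ∂μ) ψ := by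
    intro J hJ
    rw [hJ]
    intro hSJ _ _ μ _
    obtain ⟨C₁, hC₁, hμ⟩ := hHB μ
    refine ⟨-(2 * π) * C₁, mul_neg_of_neg_of_pos (neg_lt_zero.2 (by positivity)) hC₁, fun f hf hfc z => ?_⟩
    exact tendsto_deriv_two_sin_smul_integral_conj_of_chart_identity _ μ hSJ C₁ hμ f hf hfc z
  -- Step 2: the sign of `e₀` decides which standard form is congruent to `H`
  have he₀0 : e₀ ≠ 0 := fun h => by rw [h, zero_mul] at hsgn; exact lt_irrefl _ hsgn
  rcases lt_or_gt_of_ne he₀0 with hneg | hpos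
  · -- `e₀ < 0 < e₁`: `J = diag(−1, 1) = −diag(1,−1)`, `T = diag(√(−e₀), √e₁)`
    have he₁ : 0 < e₁ := by nlinarith
    have hJ : unitaryGroupOfForm (starRingEnd ℂ) (Matrix.diagonal ![(-1 : ℂ), 1]) =
        unitaryGroupOfForm (starRingEnd ℂ) (Matrix.diagonal ![(1 : ℂ), -1]) := by
      rw [← unitaryGroupOfForm_neg_eq']; congr 1; ext i j; fin_cases i <;> fin_cases j <;> simp
    have hdet : (Matrix.diagonal ![((Real.sqrt (-e₀) : ℝ) : ℂ), ((Real.sqrt e₁ : ℝ) : ℂ)]).det ≠ 0 := by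
      rw [Matrix.det_diagonal, Fin.prod_univ_two]
      simp only [Matrix.cons_val_zero, Matrix.cons_val_one]
      exact mul_ne_zero (by exact_mod_cast (Real.sqrt_pos.2 (by linarith)).ne')
        (by exact_mod_cast (Real.sqrt_pos.2 he₁).ne')
    obtain ⟨T, hT⟩ : ∃ T : GL (Fin 2) ℂ, (T : Matrix (Fin 2) (Fin 2) ℂ) =
        Matrix.diagonal ![((Real.sqrt (-e₀) : ℝ) : ℂ), ((Real.sqrt e₁ : ℝ) : ℂ)] :=
      ⟨Matrix.GeneralLinearGroup.mkOfDetNeZero _ hdet, rfl⟩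
    have hTJ : formCongr (starRingEnd ℂ) T (Matrix.diagonal ![(-1 : ℂ), 1]) = (Matrix.diagonal a).map σ := by
      rw [hH, formCongr, hT]
      have h0 : ((Real.sqrt (-e₀) : ℝ) : ℂ) * ((Real.sqrt (-e₀) : ℝ) : ℂ) = -(e₀ : ℂ) := by
        rw [← Complex.ofReal_mul, Real.mul_self_sqrt (by linarith)]; push_cast; ring
      have h1 : ((Real.sqrt e₁ : ℝ) : ℂ) * ((Real.sqrt e₁ : ℝ) : ℂ) = (e₁ : ℂ) := by
        rw [← Complex.ofReal_mul, Real.mul_self_sqrt he₁.le]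
      ext i j
      fin_cases i <;> fin_cases j <;>
        simp [Matrix.diagonal_map, Matrix.diagonal_transpose, Matrix.diagonal_mul_diagonal, Complex.conj_ofReal, h0, h1]
    exact tendsto_deriv_orbitalIntegral_of_formCongr_neg (E := E) _ _ T _ hT hTJ (fun w => circleDiagonal_mem_unitaryGroupOfForm_diagonal 2 w _)
      (circleDiagonal_mem_unitaryGroupOfForm_diagonal_map' σ a)
      (hstd _ hJ fun w => circleDiagonal_mem_unitaryGroupOfForm_diagonal 2 w _) μ₂
  · -- `e₀ > 0 > e₁`: `J = diag(1,−1)`, `T = diag(√e₀, √(−e₁))`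
    have he₁ : e₁ < 0 := by nlinarith
    have hdet : (Matrix.diagonal ![((Real.sqrt e₀ : ℝ) : ℂ), ((Real.sqrt (-e₁) : ℝ) : ℂ)]).det ≠ 0 := by
      rw [Matrix.det_diagonal, Fin.prod_univ_two]
      simp only [Matrix.cons_val_zero, Matrix.cons_val_one]
      exact mul_ne_zero (by exact_mod_cast (Real.sqrt_pos.2 hpos).ne')
        (by exact_mod_cast (Real.sqrt_pos.2 (by linarith)).ne')
    obtain ⟨T, hT⟩ : ∃ T : GL (Fin 2) ℂ, (T : Matrix (Fin 2) (Fin 2) ℂ) =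
        Matrix.diagonal ![((Real.sqrt e₀ : ℝ) : ℂ), ((Real.sqrt (-e₁) : ℝ) : ℂ)] :=
      ⟨Matrix.GeneralLinearGroup.mkOfDetNeZero _ hdet, rfl⟩
    have hTJ : formCongr (starRingEnd ℂ) T (Matrix.diagonal ![(1 : ℂ), -1]) = (Matrix.diagonal a).map σ := by
      rw [hH, formCongr, hT]
      have h0 : ((Real.sqrt e₀ : ℝ) : ℂ) * ((Real.sqrt e₀ : ℝ) : ℂ) = (e₀ : ℂ) := by
        rw [← Complex.ofReal_mul, Real.mul_self_sqrt hpos.le]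
      have h1 : ((Real.sqrt (-e₁) : ℝ) : ℂ) * ((Real.sqrt (-e₁) : ℝ) : ℂ) = -(e₁ : ℂ) := by
        rw [← Complex.ofReal_mul, Real.mul_self_sqrt (by linarith)]; push_cast; ring
      ext i j
      fin_cases i <;> fin_cases j <;>
        simp [Matrix.diagonal_map, Matrix.diagonal_transpose, Matrix.diagonal_mul_diagonal, Complex.conj_ofReal, h0, h1]
    exact tendsto_deriv_orbitalIntegral_of_formCongr_neg (E := E) _ _ T _ hT hTJ (fun w => circleDiagonal_mem_unitaryGroupOfForm_diagonal 2 w _)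
      (circleDiagonal_mem_unitaryGroupOfForm_diagonal_map' σ a)
      (hstd _ rfl fun w => circleDiagonal_mem_unitaryGroupOfForm_diagonal 2 w _) μ₂

/-! ## §3 The hypothesis-free SIGNED statement, over F0P3a-p07's orbit-chart identity ★ `ArchRankOneOrbitChart` -/
/-- **(R1G) HARISH-CHANDRA'S LIMIT FORMULA ON THE GROUP `U(e₀,e₁)`, `e₀e₁ < 0` — HYPOTHESIS-FREE, SIGNED**: `∃ C < 0` (depending on the Haar measure `μ₂` only) with
`∂_ψ [2 sin ψ · ∫_{G₂} f(h·diag(z e^{iψ}, z e^{−iψ})·h⁻¹) dμ₂] → C • f(z•1)` (`ψ → 0`, `ψ ≠ 0`) and differentiability for `0 < |ψ| < 1`, for all `f ∈ C¹_c(M₂(ℂ), E)`, `z ∈ S¹`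
(= `…_of_chart_identity` with (HB) := ★ `exists_integral_comp_conj_diag_eq_smul_integral_chart`, F0P3a-p07 p840627 — stronger than needed: all `a b : ℂ`, no support condition).
The sign socket for the (ST-∞)∕(L-use) constant identity (LEDGER v2 (A4)). [cite: Varadarajan1989, §6.4 Thm 22; Rogawski1990, §8.2 p. 119, p. 123] -/
theorem exists_tendsto_deriv_two_sin_smul_orbitalIntegral_neg {L : Type*} [CommRing L] (σ : L →+* ℂ) (a : Fin 2 → L)
    (hreal : ∀ i, (σ (a i)).im = 0) (hsgn : (σ (a 0)).re * (σ (a 1)).re < 0)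
    [MeasurableSpace ↥(unitaryGroupOfForm (starRingEnd ℂ) ((Matrix.diagonal a).map σ))] [BorelSpace ↥(unitaryGroupOfForm (starRingEnd ℂ) ((Matrix.diagonal a).map σ))] (μ₂ : Measure ↥(unitaryGroupOfForm (starRingEnd ℂ) ((Matrix.diagonal a).map σ))) [μ₂.IsHaarMeasure] :
    ∃ C : ℝ, C < 0 ∧
      ∀ (f : Matrix (Fin 2) (Fin 2) ℂ → E), ContDiff ℝ 1 f → HasCompactSupport f → ∀ z : Circle,
        Tendsto (fun ψ : ℝ => deriv (fun ψ : ℝ => (2 * Real.sin ψ) •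
            ∫ h : ↥(unitaryGroupOfForm (starRingEnd ℂ) ((Matrix.diagonal a).map σ)), f (((h * ⟨circleDiagonal 2 ![z * Circle.exp ψ, z * Circle.exp (-ψ)], circleDiagonal_mem_unitaryGroupOfForm_diagonal_map' σ a _⟩ * h⁻¹ : ↥(unitaryGroupOfForm (starRingEnd ℂ) ((Matrix.diagonal a).map σ))) :
              GL (Fin 2) ℂ) : Matrix (Fin 2) (Fin 2) ℂ) ∂μ₂) ψ)
          (𝓝[≠] 0) (𝓝 (C • f ((z : ℂ) • (1 : Matrix (Fin 2) (Fin 2) ℂ)))) ∧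
        ∀ ψ ∈ Ioo (-1 : ℝ) 1, ψ ≠ 0 → DifferentiableAt ℝ (fun ψ : ℝ => (2 * Real.sin ψ) •
            ∫ h : ↥(unitaryGroupOfForm (starRingEnd ℂ) ((Matrix.diagonal a).map σ)), f (((h * ⟨circleDiagonal 2 ![z * Circle.exp ψ, z * Circle.exp (-ψ)], circleDiagonal_mem_unitaryGroupOfForm_diagonal_map' σ a _⟩ * h⁻¹ : ↥(unitaryGroupOfForm (starRingEnd ℂ) ((Matrix.diagonal a).map σ))) :
              GL (Fin 2) ℂ) : Matrix (Fin 2) (Fin 2) ℂ) ∂μ₂) ψ :=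
  exists_tendsto_deriv_two_sin_smul_orbitalIntegral_of_chart_identity_neg σ a hreal hsgn
    (fun μ _ => by
      obtain ⟨C₁, hC₁, h⟩ := exists_integral_comp_conj_diag_eq_smul_integral_chart (E := E) μ
      exact ⟨C₁, hC₁, fun f hf _ a b _ => h f hf a b⟩) μ₂

end Literature.NumberTheory.Automorphic.UnitaryGroup
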